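import Mathlib
import HarnessLib
import Summits.HubbardSuperconductivity.HubbardSuperconductivity.Theorems.KLProgrammeKLRegimeSplitPredicates

/-!
# Route `KLProgramme`, crux K3 `KLRegimeTwoPointLimit` (stmt-HubbardSuperconductivity-19937), child 1 `KLRegimeBetaSplit` —
# the NON-COOPER HALF's core: telescoping of fixed-resolution sectorised increments, the freezing arithmetic,
# and the closed form of the remainder sums (v4-name-independent)

Cell gate-hubbard-kl, seat p1b (child-1 co-owner, non-Cooper half; g3).  Text: HOME/prover-p1b/GAINS-NOTE.md §2–§3 (Δ7).

Child 1 at scale `N` reads EVERY scale increment `A_n - A_{n-1}` (`n ≤ N`, `A_n = klEffectiveAction … n`) of the quartic kernel at its OWN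
resolution `m = N`, on the SAME resolution-`N` label tuple `Ω̄`, through the fixed-tuple `L¹` size `fixedTupleL1` of the
sectorised kernel `sectorisedKernel L M β F (·) 4` with ONE multiplier family `F = klIsoFamily … N` (this is how the amended
engine clause (E2′-v2) is stated: «for all `m ≥ n`»).  Since `sectorisedKernel L M β F G m` is `ℂ`-linear in the action `G`
([tree] `sectorisedKernel_add/_smul`), the resolution-`N` readings telescope EXACTLY,
`𝔉_Ω̄ ∗ (A_N - A_t) = Σ_{n ∈ (t, N]} 𝔉_Ω̄ ∗ (A_n - A_{n-1})`, and `fixedTupleL1` is a seminorm in the kernel; so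

  `fixedTupleL1 (𝔉 ∗ A_N) ≤ fixedTupleL1 (𝔉 ∗ A_t) + Σ_{n ∈ (t, N]} fixedTupleL1 (𝔉 ∗ (A_n - A_{n-1}))`      (`klbf_fixedTupleL1_le_base_add_sum`)

for ANY multiplier family, ANY sequence of actions and ANY leg number — no coarsening of sectors, and the transfers at which the
two-shell gains are read are the FIXED resolution-`N` centre transfers of `Ω̄` at every `n`.  With per-scale bounds of the (E2′-v2)
shape `≤ a·(g_pp n + g_d n + g_x n) + e n` and the three gain sums bounded (the `GeoConsts.WF` freezing clauses at `(m, ρ) = (N, ρ_N)`),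
the cumulative bound is `a·(C_pp + C_d + C_x) + E` (`klbf_frozen_increments`); the remainder majorant `eremBar` of
`KLProgrammeKLRegimeSplitConsts` sums over any window `Ico a b` of scales to the closed form
`cloc·(Klam U)²·r^a/(1 - r) + 2·CR·(Klam |U|)³·(1/2)^a + (Σ CL β n)/L`, `r = 4^{-θ}` (`klbf_sum_Ico_eremBar_le`) — no `|h|`.

Pure bookkeeping over landed definitions (`fixedTupleL1`, `sectorisedKernel`, `eremBar`); nothing is asserted about the model.
References: HOME/prover-p1b/GAINS-NOTE.md; HOME/DECOMP.md App. E E2 (a)(d), Lemma E.1/E.3; BGM 2006 §3 (3.65)–(3.66).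
-/

noncomputable section

namespace Summit.HubbardSuperconductivity.HubbardSuperconductivity.Theorems.KLRegimeSplit

set_option linter.dupNamespace false -- summit = problem name (single-conjunct summit), D-0017

open Real Finset Literature.MathematicalPhysics.QuantumLattice Literature.Probability.LatticeModels
open Literature.MathematicalPhysics.QuantumLattice.FermiRG
open Summit.HubbardSuperconductivity.HubbardSuperconductivity.Theorems.KLProgrammeLegKernels
open Summit.HubbardSuperconductivity.HubbardSuperconductivity.Theorems.CooperChannelRiccatiFlow

/-! ## §1 Telescoping and window sums over scales -/

/-- Telescoping over the scale window `(t, N]`: `Σ_{n ∈ Ioc t N} (f n - f (n-1)) = f N - f t`. -/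
theorem klbf_sum_Ioc_sub_telescope {G : Type*} [AddCommGroup G] (f : ℕ → G) {t N : ℕ} (h : t ≤ N) :
    ∑ n ∈ Ioc t N, (f n - f (n - 1)) = f N - f t := by
  induction N, h using Nat.le_induction with
  | base => simp
  | succ N hN ih =>
    rw [sum_Ioc_succ_top hN, ih, Nat.add_sub_cancel]
    abel

/-- A window sum of a nonnegative sequence is bounded by the full sum up to the top of the window:
`Σ_{n ∈ Ioc t N} g n ≤ Σ_{n ∈ range (N+1)} g n`. -/
theorem klbf_sum_Ioc_le_sum_range {g : ℕ → ℝ} (hg : ∀ n, 0 ≤ g n) (t N : ℕ) :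
    ∑ n ∈ Ioc t N, g n ≤ ∑ n ∈ range (N + 1), g n := by
  refine sum_le_sum_of_subset_of_nonneg (fun n hn => ?_) fun n _ _ => hg n
  rw [mem_Ioc] at hn
  rw [mem_range]
  omega

/-- `Ioc t N = Ico (t+1) (N+1)` on `ℕ`. -/
theorem klbf_Ioc_eq_Ico (t N : ℕ) : Ioc t N = Ico (t + 1) (N + 1) := by
  ext n; simp only [mem_Ioc, mem_Ico]; omega

/-! ## §2 `fixedTupleL1` is a seminorm in the kernel -/

section FixedTuple

variable {L M : ℕ} [NeZero L]

/-- `fixedTupleL1` is nonnegative (for `β ≥ 0`). -/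
theorem klbf_fixedTupleL1_nonneg {N : ℕ} {β : ℝ} (hβ : 0 ≤ β) (m : ℕ)
    (W : (Fin (m + 1) → SectorLeg N) → (Fin (m + 1) → SpaceTimeIdx L M) → ℂ)
    (Ω : Fin (m + 1) → SectorLeg N) (x₁ : SpaceTimeIdx L M) : 0 ≤ fixedTupleL1 L M β m W Ω x₁ := by
  unfold fixedTupleL1
  exact mul_nonneg (pow_nonneg (imagTimeWeight_nonneg hβ M) _) (sum_nonneg fun _ _ => norm_nonneg _)

/-- `fixedTupleL1` of the zero kernel vanishes. -/
@[simp] theorem klbf_fixedTupleL1_zero {N : ℕ} (β : ℝ) (m : ℕ) (Ω : Fin (m + 1) → SectorLeg N) (x₁ : SpaceTimeIdx L M) :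
    fixedTupleL1 L M β m (0 : (Fin (m + 1) → SectorLeg N) → (Fin (m + 1) → SpaceTimeIdx L M) → ℂ) Ω x₁ = 0 := by
  simp [fixedTupleL1]

/-- `fixedTupleL1` is subadditive in the kernel (for `β ≥ 0`). -/
theorem klbf_fixedTupleL1_add_le {N : ℕ} {β : ℝ} (hβ : 0 ≤ β) (m : ℕ)
    (W₁ W₂ : (Fin (m + 1) → SectorLeg N) → (Fin (m + 1) → SpaceTimeIdx L M) → ℂ)
    (Ω : Fin (m + 1) → SectorLeg N) (x₁ : SpaceTimeIdx L M) :
    fixedTupleL1 L M β m (W₁ + W₂) Ω x₁ ≤ fixedTupleL1 L M β m W₁ Ω x₁ + fixedTupleL1 L M β m W₂ Ω x₁ := by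
  simp only [fixedTupleL1, Pi.add_apply]
  rw [← mul_add, ← sum_add_distrib]
  exact mul_le_mul_of_nonneg_left (sum_le_sum fun x _ => norm_add_le _ _)
    (pow_nonneg (imagTimeWeight_nonneg hβ M) _)

/-- `fixedTupleL1` of a finite sum of kernels is at most the sum of the `fixedTupleL1`'s (for `β ≥ 0`). -/
theorem klbf_fixedTupleL1_sum_le {N : ℕ} {β : ℝ} (hβ : 0 ≤ β) (m : ℕ) {ι : Type*} (s : Finset ι)
    (W : ι → (Fin (m + 1) → SectorLeg N) → (Fin (m + 1) → SpaceTimeIdx L M) → ℂ)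
    (Ω : Fin (m + 1) → SectorLeg N) (x₁ : SpaceTimeIdx L M) :
    fixedTupleL1 L M β m (∑ i ∈ s, W i) Ω x₁ ≤ ∑ i ∈ s, fixedTupleL1 L M β m (W i) Ω x₁ := by
  classical
  induction s using Finset.induction_on with
  | empty => simp
  | insert a s ha ih =>
    rw [sum_insert ha, sum_insert ha]
    exact (klbf_fixedTupleL1_add_le hβ m _ _ Ω x₁).trans (add_le_add le_rfl ih)

/-! ## §3 Sectorised kernels are linear in the action: differences and telescoping at FIXED resolution -/

/-- Sectorised kernels respect subtraction of actions. -/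
theorem klbf_sectorisedKernel_sub {Nsec : ℕ} (β : ℝ) (F : Fin Nsec → FreqMomentum L M → ℂ)
    (G G' : HubbardGrassmann L M) (m : ℕ) :
    sectorisedKernel L M β F (G - G') m = sectorisedKernel L M β F G m - sectorisedKernel L M β F G' m := by
  rw [sub_eq_add_neg, sectorisedKernel_add, ← neg_one_smul ℂ G', sectorisedKernel_smul, neg_one_smul,
    ← sub_eq_add_neg]

/-- **Telescoping at fixed resolution.**  For one multiplier family `F` and any sequence of actions `A`, the sectorisation of
`A_N - A_t` is the sum over the window `(t, N]` of the sectorised increments `A_n - A_{n-1}`. -/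
theorem klbf_sectorisedKernel_telescope {Nsec : ℕ} (β : ℝ) (F : Fin Nsec → FreqMomentum L M → ℂ)
    (A : ℕ → HubbardGrassmann L M) (m : ℕ) {t N : ℕ} (h : t ≤ N) :
    sectorisedKernel L M β F (A N - A t) m = ∑ n ∈ Ioc t N, sectorisedKernel L M β F (A n - A (n - 1)) m := by
  simp_rw [klbf_sectorisedKernel_sub]
  exact (klbf_sum_Ioc_sub_telescope (fun n => sectorisedKernel L M β F (A n) m) h).symm

/-- **The fixed-tuple `L¹` size of a fixed-resolution difference is at most the sum of the increments' sizes** (`β ≥ 0`). -/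
theorem klbf_fixedTupleL1_telescope_le {Nsec : ℕ} {β : ℝ} (hβ : 0 ≤ β) (F : Fin Nsec → FreqMomentum L M → ℂ)
    (A : ℕ → HubbardGrassmann L M) (m : ℕ) {t N : ℕ} (h : t ≤ N) (Ω : Fin (m + 1) → SectorLeg Nsec)
    (x₁ : SpaceTimeIdx L M) :
    fixedTupleL1 L M β m (sectorisedKernel L M β F (A N - A t) (m + 1)) Ω x₁ ≤
      ∑ n ∈ Ioc t N, fixedTupleL1 L M β m (sectorisedKernel L M β F (A n - A (n - 1)) (m + 1)) Ω x₁ := by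
  rw [klbf_sectorisedKernel_telescope β F A (m + 1) h]
  exact klbf_fixedTupleL1_sum_le hβ m _ _ Ω x₁

/-- **Base plus increments.**  `fixedTupleL1 (𝔉 ∗ A_N) ≤ fixedTupleL1 (𝔉 ∗ A_t) + Σ_{n ∈ (t, N]} fixedTupleL1 (𝔉 ∗ (A_n - A_{n-1}))`
at ONE resolution (the multiplier family `F`), for any leg number. -/
theorem klbf_fixedTupleL1_le_base_add_sum {Nsec : ℕ} {β : ℝ} (hβ : 0 ≤ β) (F : Fin Nsec → FreqMomentum L M → ℂ)
    (A : ℕ → HubbardGrassmann L M) (m : ℕ) {t N : ℕ} (h : t ≤ N) (Ω : Fin (m + 1) → SectorLeg Nsec)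
    (x₁ : SpaceTimeIdx L M) :
    fixedTupleL1 L M β m (sectorisedKernel L M β F (A N) (m + 1)) Ω x₁ ≤
      fixedTupleL1 L M β m (sectorisedKernel L M β F (A t) (m + 1)) Ω x₁ +
        ∑ n ∈ Ioc t N, fixedTupleL1 L M β m (sectorisedKernel L M β F (A n - A (n - 1)) (m + 1)) Ω x₁ := by
  have hsplit : sectorisedKernel L M β F (A N) (m + 1) =
      sectorisedKernel L M β F (A N - A t) (m + 1) + sectorisedKernel L M β F (A t) (m + 1) := by
    rw [← sectorisedKernel_add, sub_add_cancel]
  rw [hsplit]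
  refine (klbf_fixedTupleL1_add_le hβ m _ _ Ω x₁).trans ?_
  rw [add_comm]
  exact add_le_add le_rfl (klbf_fixedTupleL1_telescope_le hβ F A m h Ω x₁)

/-! ## §4 The freezing arithmetic -/

omit [NeZero L] in
/-- **Freezing arithmetic (abstract).**  Per-scale bounds `incr n ≤ a·(g₁ n + g₂ n + g₃ n) + e n` on a window of scales with the three
gain sums and the remainder sum bounded give the cumulative bound `a·(C₁ + C₂ + C₃) + E`. -/
theorem klbf_sum_le_of_perScale {s : Finset ℕ} {incr g₁ g₂ g₃ e : ℕ → ℝ} {a C₁ C₂ C₃ E : ℝ} (ha : 0 ≤ a)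
    (h : ∀ n ∈ s, incr n ≤ a * (g₁ n + g₂ n + g₃ n) + e n)
    (h₁ : ∑ n ∈ s, g₁ n ≤ C₁) (h₂ : ∑ n ∈ s, g₂ n ≤ C₂) (h₃ : ∑ n ∈ s, g₃ n ≤ C₃) (hE : ∑ n ∈ s, e n ≤ E) :
    ∑ n ∈ s, incr n ≤ a * (C₁ + C₂ + C₃) + E := by
  calc ∑ n ∈ s, incr n ≤ ∑ n ∈ s, (a * (g₁ n + g₂ n + g₃ n) + e n) := sum_le_sum h
    _ = a * (∑ n ∈ s, g₁ n + ∑ n ∈ s, g₂ n + ∑ n ∈ s, g₃ n) + ∑ n ∈ s, e n := by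
        rw [sum_add_distrib, ← mul_sum, sum_add_distrib, sum_add_distrib]
    _ ≤ a * (C₁ + C₂ + C₃) + E :=
        add_le_add (mul_le_mul_of_nonneg_left (by linarith) ha) hE

/-- **Frozen increments (the non-Cooper half's sum, GAINS-NOTE §2 (ii)).**  At one resolution (`F`), on one tuple `Ω̄`: if every
scale increment in the window `(t, N]` obeys the (E2′-v2)-shaped bound `≤ a·(g_pp n + g_d n + g_x n) + e n` and the three gain sums and
the remainder sum over the window are bounded by `C_pp, C_d, C_x, E`, then
`fixedTupleL1 (𝔉 ∗ A_N) ≤ fixedTupleL1 (𝔉 ∗ A_t) + a·(C_pp + C_d + C_x) + E`. -/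
theorem klbf_frozen_increments {Nsec : ℕ} {β : ℝ} (hβ : 0 ≤ β) (F : Fin Nsec → FreqMomentum L M → ℂ)
    (A : ℕ → HubbardGrassmann L M) (m : ℕ) {t N : ℕ} (h : t ≤ N) (Ω : Fin (m + 1) → SectorLeg Nsec)
    (x₁ : SpaceTimeIdx L M) {a : ℝ} (ha : 0 ≤ a) {gpp gd gx e : ℕ → ℝ} {Cpp Cd Cx E : ℝ}
    (hincr : ∀ n ∈ Ioc t N,
      fixedTupleL1 L M β m (sectorisedKernel L M β F (A n - A (n - 1)) (m + 1)) Ω x₁ ≤ a * (gpp n + gd n + gx n) + e n)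
    (hpp : ∑ n ∈ Ioc t N, gpp n ≤ Cpp) (hd : ∑ n ∈ Ioc t N, gd n ≤ Cd) (hx : ∑ n ∈ Ioc t N, gx n ≤ Cx)
    (hE : ∑ n ∈ Ioc t N, e n ≤ E) :
    fixedTupleL1 L M β m (sectorisedKernel L M β F (A N) (m + 1)) Ω x₁ ≤
      fixedTupleL1 L M β m (sectorisedKernel L M β F (A t) (m + 1)) Ω x₁ + (a * (Cpp + Cd + Cx) + E) :=
  (klbf_fixedTupleL1_le_base_add_sum hβ F A m h Ω x₁).trans
    (add_le_add le_rfl (klbf_sum_le_of_perScale ha hincr hpp hd hx hE))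

end FixedTuple

/-! ## §5 The remainder sums: closed form of `Σ eremBar` over a window of scales -/

/-- The ladder-localisation slack `4^{-θ n}` is a geometric sequence: `4^{-(θ n)} = (4^{-θ})^n`. -/
theorem klbf_rpow_neg_mul_nat (θ : ℝ) (n : ℕ) : (4 : ℝ) ^ (-(θ * n)) = ((4 : ℝ) ^ (-θ)) ^ n := by
  rw [show (-(θ * n) : ℝ) = (-θ) * (n : ℝ) by ring, Real.rpow_mul (by norm_num : (0 : ℝ) ≤ 4),
    Real.rpow_natCast]

/-- For `θ > 0` the ratio `r = 4^{-θ}` lies in `(0, 1)`. -/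
theorem klbf_ratio_mem (θ : ℝ) (hθ : 0 < θ) : 0 < (4 : ℝ) ^ (-θ) ∧ (4 : ℝ) ^ (-θ) < 1 :=
  ⟨Real.rpow_pos_of_pos (by norm_num) _, Real.rpow_lt_one_of_one_lt_of_neg (by norm_num) (by linarith)⟩

/-- Geometric window sum of the localisation slack: `Σ_{n ∈ Ico a b} 4^{-θ n} ≤ r^a / (1 - r)`, `r = 4^{-θ}`, `θ > 0`. -/
theorem klbf_sum_Ico_slack_le {θ : ℝ} (hθ : 0 < θ) (a b : ℕ) :
    ∑ n ∈ Ico a b, (4 : ℝ) ^ (-(θ * n)) ≤ ((4 : ℝ) ^ (-θ)) ^ a / (1 - (4 : ℝ) ^ (-θ)) := by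
  simp_rw [klbf_rpow_neg_mul_nat]
  obtain ⟨h0, h1⟩ := klbf_ratio_mem θ hθ
  exact geom_sum_Ico_le_of_lt_one h0.le h1

/-- Geometric window sum of the cubic-remainder weights: `Σ_{n ∈ Ico a b} (2^n)⁻¹ ≤ 2·(1/2)^a`. -/
theorem klbf_sum_Ico_half_le (a b : ℕ) : ∑ n ∈ Ico a b, ((2 : ℝ) ^ n)⁻¹ ≤ 2 * (1 / 2 : ℝ) ^ a := by
  have h : ∑ n ∈ Ico a b, ((2 : ℝ) ^ n)⁻¹ = ∑ n ∈ Ico a b, (1 / 2 : ℝ) ^ n :=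
    sum_congr rfl fun n _ => by rw [one_div, inv_pow]
  rw [h]
  calc ∑ n ∈ Ico a b, (1 / 2 : ℝ) ^ n ≤ (1 / 2 : ℝ) ^ a / (1 - 1 / 2) :=
        geom_sum_Ico_le_of_lt_one (by norm_num) (by norm_num)
    _ = 2 * (1 / 2 : ℝ) ^ a := by ring

/-- **Closed form of the remainder sum over a window of scales** (GAINS-NOTE §2 (ii)): for `cloc, CR, Klam ≥ 0`, `θ > 0`,
`Σ_{n ∈ Ico a b} ē_n ≤ cloc·(Klam U)²·r^a/(1 - r) + CR·(Klam|U|)³·2·(1/2)^a + (Σ_{n ∈ Ico a b} CL β n)/L`, `r = 4^{-θ}` — the first two are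
geometric (no `|h|`), the third is killed by the volume threshold (`L ≥ L₁ β U`). -/
theorem klbf_sum_Ico_eremBar_le (G : GeoConsts) (P : SplitConsts) (Q : EngConsts) (hcloc : 0 ≤ G.cloc) (hθ : 0 < G.θ)
    (hCR : 0 ≤ Q.CR) (hK : 0 ≤ P.Klam) (U β : ℝ) (L a b : ℕ) :
    ∑ n ∈ Ico a b, eremBar G P Q U β L n ≤
      G.cloc * (P.Klam * U) ^ 2 * (((4 : ℝ) ^ (-G.θ)) ^ a / (1 - (4 : ℝ) ^ (-G.θ))) +
        Q.CR * (P.Klam * |U|) ^ 3 * (2 * (1 / 2 : ℝ) ^ a) + (∑ n ∈ Ico a b, Q.CL β n) / L := by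
  simp only [eremBar]
  rw [sum_add_distrib, sum_add_distrib, ← mul_sum, ← mul_sum, ← sum_div]
  have h1 : G.cloc * (P.Klam * U) ^ 2 * ∑ n ∈ Ico a b, (4 : ℝ) ^ (-(G.θ * n)) ≤
      G.cloc * (P.Klam * U) ^ 2 * (((4 : ℝ) ^ (-G.θ)) ^ a / (1 - (4 : ℝ) ^ (-G.θ))) :=
    mul_le_mul_of_nonneg_left (klbf_sum_Ico_slack_le hθ a b) (mul_nonneg hcloc (sq_nonneg _))
  have h2 : Q.CR * (P.Klam * |U|) ^ 3 * ∑ n ∈ Ico a b, ((2 : ℝ) ^ n)⁻¹ ≤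
      Q.CR * (P.Klam * |U|) ^ 3 * (2 * (1 / 2 : ℝ) ^ a) :=
    mul_le_mul_of_nonneg_left (klbf_sum_Ico_half_le a b)
      (mul_nonneg hCR (pow_nonneg (mul_nonneg hK (abs_nonneg U)) 3))
  linarith

/-- The same from the well-formedness predicates `G.WF`, `P.WF`, `Q.WF`. -/
theorem klbf_sum_Ico_eremBar_le_of_WF {G : GeoConsts} {P : SplitConsts} {Q : EngConsts} (hG : G.WF) (hP : P.WF)
    (hQ : Q.WF) (U β : ℝ) (L a b : ℕ) :
    ∑ n ∈ Ico a b, eremBar G P Q U β L n ≤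
      G.cloc * (P.Klam * U) ^ 2 * (((4 : ℝ) ^ (-G.θ)) ^ a / (1 - (4 : ℝ) ^ (-G.θ))) +
        Q.CR * (P.Klam * |U|) ^ 3 * (2 * (1 / 2 : ℝ) ^ a) + (∑ n ∈ Ico a b, Q.CL β n) / L := by
  obtain ⟨-, -, -, -, hcloc, hθ, -⟩ := hG
  obtain ⟨hK, -⟩ := hP
  obtain ⟨-, hCR, -⟩ := hQ
  exact klbf_sum_Ico_eremBar_le G P Q hcloc hθ hCR (by linarith) U β L a b

/-- **Cumulative remainder from the top of the ultraviolet** (`a = 0`): `Σ_{n < b} ē_n ≤ cloc(Klam U)²/(1 - 4^{-θ}) + 2CR(Klam|U|)³ + (Σ_{n<b} CL β n)/L`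
— `O(U²)` once `L` clears the `CL`-sum, uniformly in the number of scales `b`. -/
theorem klbf_sum_range_eremBar_le_of_WF {G : GeoConsts} {P : SplitConsts} {Q : EngConsts} (hG : G.WF) (hP : P.WF)
    (hQ : Q.WF) (U β : ℝ) (L b : ℕ) :
    ∑ n ∈ range b, eremBar G P Q U β L n ≤
      G.cloc * (P.Klam * U) ^ 2 * (1 / (1 - (4 : ℝ) ^ (-G.θ))) +
        Q.CR * (P.Klam * |U|) ^ 3 * 2 + (∑ n ∈ range b, Q.CL β n) / L := by
  have h := klbf_sum_Ico_eremBar_le_of_WF hG hP hQ U β L 0 b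
  simp only [pow_zero, mul_one] at h
  rwa [Nat.Ico_zero_eq_range] at h

end Summit.HubbardSuperconductivity.HubbardSuperconductivity.Theorems.KLRegimeSplit

end
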